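import Summits.HodgeConjecture.HodgeConjecture.Theorems.F0P3cStCharTSStJH                -- ★ ST-JH milieu: `Gqs`, ★ TorusCompactPart `valued_apply_eq_one_of_mem_normOneUnits`
import Literature.NumberTheory.Automorphic.UnitaryBruhatIwahoriThree                      -- ★★ p853045∕p853060 BRUHAT–IWAHORI (LH5-p05): `cover_borelU_inf`, `disj_borelU_inf`, …
import Literature.NumberTheory.Automorphic.CMLocalNonsplitBorelTransport                   -- ★ `localNonsplitEquiv_apply_apply`, `apply_eq_zero_iff_apply_apply_eq_zero`
import Literature.NumberTheory.Automorphic.UnitaryLatticeTreeLevelIndices                   -- ★ (G0) p852870: the levels are compact open in the model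
import HarnessLib

/-!
# F0 · P3c · line LH6 «StCharTS» — (G6)-ST FILE C «LEVELS TRANSPORT»: the Bruhat–Iwahori ∕ type-two Mackey binders of `U(σ_w, Φ₃)(L_w)` pulled back to
# `G_v = U(Φ₃)(L⁺_v)` along the one-place model `eA` of ★ (G3)-EXPLICIT (RIDER 2b «EP-PAIRS», census EP-PAIRS v1 §3 (4) §5)

Cell `pub/hodgecm-mathlib` (D-0151), FLOOR 0, crux item H413 = `stmt-HodgeConjecture-24833` (`--supports` lane, helper; seat F0P3a-p06 (g25)).  THEOREMS ONLY; letters =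
★ (G3)-EXPLICIT `epFunction_G_explicit`'s binders `(w) (hw) (hd) (g₁) (hg₁) (eA) (heA) (K0 K1 I) (hK0 hK1 hI)` verbatim, so that the EP-PAIRS assembly instantiates this file
and (G3) with the same `rfl` ×4.  HONEST LABEL: count-neutral (group-theoretic transport for 2b; closes no node); HC_CM is proved only modulo the 7 printed citations
(hLiu418 = stmt-HodgeConjecture-24832, h413 = stmt-HodgeConjecture-24833) until rung 0 closes.

MATHEMATICS [BruhatTits1972 (4.4.4); Tits1979 §3.3–§3.7; PlatonovRapinchuk1994 §5.1].  `eA : G_v ≃ₜ* U(σ_w, Φ₃)(L_w)` reads matrix entries at the unique place `w ∣ v`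
(`heA`, ★ `localNonsplitEquiv_apply_apply`), so (§1) `K0 = K_v` (★ `mem_localIntegralLevel_iff_of_smul_eq`), `eA` respects the Borels (upper-triangularity is entrywise),
the torus elements `d(1,b,1)` of FILE A lie in `I ≤ K1`, and the diagonal of an element of `B ∩ K1` consists of units; (§2) the ★ decompositions `U = B·I ⊔ B·w·I`,
`U = B·K₁` of the model pull back to the MACKEY binders `hcover`∕`hdisj` at `H := B_v = (cmBorelTriple L 3 v).P`, `K := I`, `g := ![1, eA⁻¹ w]`, resp. `K := K1`, `ι := Unit`.

* §1 `coe_eA_apply`, **`mem_K0_iff_mem_integralLevel`**, `eA_mem_borelU_iff`, `eA_symm_mem_borel`, `mem_I_of_coe_eq_diagonal` ∕ `mem_K1_of_coe_eq_diagonal`, `eA_symm_weylLongU_mem_K0`,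
  `valued_diag_eq_one_of_mem_borel_of_forall_le` (diagonal of `b ∈ B` integral ⇒ units), `valued_torusEntry_proj_eq_one_of_mem_K1`
* §2 `symm_mem_comap_iff`, `mem_comap_iff`, `eA_vec`, **`cover_borel_I`**, **`disj_borel_I`**, **`cover_borel_K1`** · §3 `isOpen_isCompact_levels`.

## References
* [BruhatTits1972] F. Bruhat, J. Tits, *Groupes réductifs sur un corps local I*, Publ. Math. IHÉS 41 (1972), (4.4.3)–(4.4.4).
* [Tits1979] J. Tits, *Reductive groups over local fields*, PSPM 33.1 (1979), §3.3–§3.7.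
* [PlatonovRapinchuk1994] V. Platonov, A. Rapinchuk, *Algebraic Groups and Number Theory* (1994), §5.1 (the one-place model at a non-split place).
* [Rogawski1990] J. D. Rogawski, *Automorphic Representations of Unitary Groups in Three Variables*, Ann. of Math. Stud. 123 (1990), §1.10 p. 9, §4.5 p. 45.
* [Casselman1995] W. Casselman, *Introduction to the theory of admissible representations of 𝔭-adic reductive groups* (1995), Prop. 1.3.1, §3.
-/

set_option autoImplicit false
-- the mandated namespace has the single-problem summit's repeated segment (`HodgeConjecture.HodgeConjecture`)
set_option linter.dupNamespace false

noncomputable section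

open NumberField IsDedekindDomain MeasureTheory
open scoped Matrix MatrixGroups NNReal WithZero
open Literature.NumberTheory.Automorphic Literature.NumberTheory.Automorphic.UnitaryGroup
open Literature.NumberTheory.Rogawski1990 Literature.NumberTheory.GaloisRepresentations

namespace Summit.HodgeConjecture.HodgeConjecture.Cruxes.H413.F0P3cStCharTSStLevelsTransport

open Summit.HodgeConjecture.HodgeConjecture.Cruxes.H413

variable (L : Type) [Field L] [NumberField L] [IsCMField L] (v : HeightOneSpectrum (𝓞 ↥(maximalRealSubfield L)))
  (w : PlacesOver L v) (hw : IsCMField.complexConj L • w.1 = w.1)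
  (eA : Gqs L v ≃ₜ* ↥(unitaryGroupOfForm (galAdicCompletionMap (L := L) (IsCMField.complexConj L) hw) ((StdForm.antidiagonal 3).over (w.1.adicCompletion L))))
  (heA : ∀ g : Gqs L v,
    ((eA g : ↥(unitaryGroupOfForm (galAdicCompletionMap (L := L) (IsCMField.complexConj L) hw) ((StdForm.antidiagonal 3).over (w.1.adicCompletion L)))) :
        GL (Fin 3) (w.1.adicCompletion L)) =
      ((localNonsplitEquiv (IsCMField.complexConj L) (qsForm L) (IsCMField.complexConj_ne_one L) w hw g :
        ↥(unitaryGroupOfForm (galAdicCompletionMap (L := L) (IsCMField.complexConj L) hw) (placeForm (qsForm L) w.1))) : GL (Fin 3) (w.1.adicCompletion L)))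

/-! ## §1 Entries, the hyperspecial level, the Borel, the torus elements `d(1,b,1)` through `eA` -/

include heA in
/-- **`(eA g)ᵢⱼ = gᵢⱼ(w)`** (`heA` + ★ `localNonsplitEquiv_apply_apply`). [cite: PlatonovRapinchuk1994, §5.1] -/
theorem coe_eA_apply (g : Gqs L v) (i j : Fin 3) :
    (((eA g : ↥(unitaryGroupOfForm (galAdicCompletionMap (L := L) (IsCMField.complexConj L) hw) ((StdForm.antidiagonal 3).over (w.1.adicCompletion L)))) :
        GL (Fin 3) (w.1.adicCompletion L)) : Matrix (Fin 3) (Fin 3) (w.1.adicCompletion L)) i j =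
      (g.val.val : Matrix (Fin 3) (Fin 3) (LocalRing L v)) i j w := by
  rw [heA]
  exact localNonsplitEquiv_apply_apply L v w hw g i j

include heA in
/-- **`K0 = K_v`**: the hyperspecial level of ★ (G3)-EXPLICIT (`eA⁻¹(GL₃(𝒪_w) ∩ U)`) IS ★ `cmLocalIntegralLevel` (★ `mem_localIntegralLevel_iff_of_smul_eq` + `heA`).
[cite: PlatonovRapinchuk1994, §5.1] [cite: Rogawski1990, §4.5 p. 45] -/
theorem mem_K0_iff_mem_integralLevel (K0 : Subgroup (Gqs L v))
    (hK0 : K0 = ((glInt 3 (w.1.adicCompletion L)).subgroupOf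
      (unitaryGroupOfForm (galAdicCompletionMap (L := L) (IsCMField.complexConj L) hw) ((StdForm.antidiagonal 3).over (w.1.adicCompletion L)))).comap
        eA.toMulEquiv.toMonoidHom) (g : Gqs L v) :
    g ∈ K0 ↔ g ∈ cmLocalIntegralLevel L 3 (qsForm L) v := by
  rw [hK0, Subgroup.mem_comap, Subgroup.mem_subgroupOf]
  change ((eA g : ↥(unitaryGroupOfForm (galAdicCompletionMap (L := L) (IsCMField.complexConj L) hw) ((StdForm.antidiagonal 3).over (w.1.adicCompletion L)))) :
      GL (Fin 3) (w.1.adicCompletion L)) ∈ glInt 3 (w.1.adicCompletion L) ↔ _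
  rw [heA]
  haveI : Algebra.IsQuadraticExtension ↥(maximalRealSubfield L) L := IsCMField.isQuadraticExtension L
  exact (mem_localIntegralLevel_iff_of_smul_eq (IsCMField.complexConj L) 3 (qsForm L) (IsCMField.complexConj_ne_one L) w hw g).symm

include heA in
/-- **`eA` respects the Borels**: `eA g` is upper triangular iff `g` is (entrywise at `w`, ★ `apply_eq_zero_iff_apply_apply_eq_zero`). [cite: PlatonovRapinchuk1994, §5.1]
[cite: Rogawski1990, §1.10 p. 9] -/
theorem eA_mem_borelU_iff (g : Gqs L v) :
    eA g ∈ borelU (galAdicCompletionMap (L := L) (IsCMField.complexConj L) hw) ((StdForm.antidiagonal 3).over (w.1.adicCompletion L)) ↔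
      (g : ↥(unitaryGroupOfForm (conjLocal L (IsCMField.complexConj L) v) (cmLocalForm L 3 v))) ∈ (cmBorelTriple L 3 v).P := by
  rw [mem_borelU_iff]
  change _ ↔ Matrix.BlockTriangular (g.val.val : Matrix (Fin 3) (Fin 3) (LocalRing L v)) id
  constructor
  · intro h i j hij
    have h1 := h hij
    rw [coe_eA_apply L v w hw eA heA g i j] at h1
    exact (apply_eq_zero_iff_apply_apply_eq_zero L v w hw _).2 h1
  · intro h i j hij
    rw [coe_eA_apply L v w hw eA heA g i j]
    exact (apply_eq_zero_iff_apply_apply_eq_zero L v w hw _).1 (h hij)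

include heA in
/-- `eA⁻¹ b ∈ B_v` for `b ∈ B(L_w)`. [cite: PlatonovRapinchuk1994, §5.1] -/
theorem eA_symm_mem_borel
    {b : ↥(unitaryGroupOfForm (galAdicCompletionMap (L := L) (IsCMField.complexConj L) hw) ((StdForm.antidiagonal 3).over (w.1.adicCompletion L)))}
    (hb : b ∈ borelU (galAdicCompletionMap (L := L) (IsCMField.complexConj L) hw) ((StdForm.antidiagonal 3).over (w.1.adicCompletion L))) :
    (eA.symm b : ↥(unitaryGroupOfForm (conjLocal L (IsCMField.complexConj L) v) (cmLocalForm L 3 v))) ∈ (cmBorelTriple L 3 v).P := by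
  rw [← eA_mem_borelU_iff L v w hw eA heA, ContinuousMulEquiv.apply_symm_apply]
  exact hb

include heA in
/-- **An element of `G_v` with matrix `diag(1, b, 1)`, `b ∈ E¹_v`, lies in the Iwahori level `I = K0 ⊓ K1`** (its `eA`-image is `diag(1, b_w, 1)`, integral with vanishing
`(1,0),(2,0),(2,1)` entries: ★ `mem_glInt_inf_conj_glInt_iff`). [cite: Tits1979, §3.7] [cite: Rogawski1990, §1.10 p. 9] -/
theorem mem_I_of_coe_eq_diagonal (hns : ∀ w' : PlacesOver L v, IsCMField.complexConj L • w'.1 = w'.1)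
    {ϖ : w.1.adicCompletion L} (hd : HermitianLattice.UnramifiedLocalConjDatum (galAdicCompletionMap (L := L) (IsCMField.complexConj L) hw) ϖ)
    (g₁ : GL (Fin 3) (w.1.adicCompletion L)) (hg₁ : (g₁ : Matrix (Fin 3) (Fin 3) (w.1.adicCompletion L)) = Matrix.diagonal ![(1 : w.1.adicCompletion L), 1, ϖ])
    (K0 K1 I : Subgroup (Gqs L v))
    (hK0 : K0 = ((glInt 3 (w.1.adicCompletion L)).subgroupOf
      (unitaryGroupOfForm (galAdicCompletionMap (L := L) (IsCMField.complexConj L) hw) ((StdForm.antidiagonal 3).over (w.1.adicCompletion L)))).comap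
        eA.toMulEquiv.toMonoidHom)
    (hK1 : K1 = (((glInt 3 (w.1.adicCompletion L)).map (MulAut.conj g₁).toMonoidHom).subgroupOf
      (unitaryGroupOfForm (galAdicCompletionMap (L := L) (IsCMField.complexConj L) hw) ((StdForm.antidiagonal 3).over (w.1.adicCompletion L)))).comap
        eA.toMulEquiv.toMonoidHom)
    (hI : I = K0 ⊓ K1)
    (b : ↥(normOneUnits (conjLocal L (IsCMField.complexConj L) v))) (g : Gqs L v)
    (hg : (g.val.val : Matrix (Fin 3) (Fin 3) (LocalRing L v)) =
      Matrix.diagonal ![(1 : LocalRing L v), ((b : (LocalRing L v)ˣ) : LocalRing L v), 1]) :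
    g ∈ I := by
  subst hI hK0 hK1
  rw [Subgroup.mem_inf, Subgroup.mem_comap, Subgroup.mem_comap]
  change eA g ∈ (glInt 3 (w.1.adicCompletion L)).subgroupOf _ ∧ eA g ∈ ((glInt 3 (w.1.adicCompletion L)).map (MulAut.conj g₁).toMonoidHom).subgroupOf _
  rw [← Subgroup.mem_inf, mem_glInt_inf_conj_glInt_iff (galAdicCompletionMap (L := L) (IsCMField.complexConj L) hw) rfl hd.vσ hd.vϖ g₁ hg₁]
  have hb1 : Valued.v (((b : (LocalRing L v)ˣ) : LocalRing L v) w) = 1 :=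
    F0P3cStCharTSTorusCompactPart.valued_apply_eq_one_of_mem_normOneUnits L v hns b.2 w
  have hent : ∀ i j : Fin 3, (((eA g : ↥(unitaryGroupOfForm (galAdicCompletionMap (L := L) (IsCMField.complexConj L) hw)
      ((StdForm.antidiagonal 3).over (w.1.adicCompletion L)))) : GL (Fin 3) (w.1.adicCompletion L)) : Matrix (Fin 3) (Fin 3) (w.1.adicCompletion L)) i j =
        (Matrix.diagonal ![(1 : LocalRing L v), ((b : (LocalRing L v)ˣ) : LocalRing L v), 1] i j) w := by
    intro i j
    rw [coe_eA_apply L v w hw eA heA g i j, hg]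
  refine ⟨fun i j => ?_, ?_, ?_, ?_⟩
  · rw [hent, Matrix.diagonal_apply]
    split_ifs with hij
    · subst hij
      fin_cases i
      · show Valued.v (((1 : LocalRing L v)) w) ≤ 1
        rw [Pi.one_apply, map_one]
      · exact hb1.le
      · show Valued.v (((1 : LocalRing L v)) w) ≤ 1
        rw [Pi.one_apply, map_one]
    · rw [Pi.zero_apply, map_zero]; exact zero_le
  · rw [hent, Matrix.diagonal_apply_ne _ (by decide), Pi.zero_apply, map_zero]; exact zero_lt_one
  · rw [hent, Matrix.diagonal_apply_ne _ (by decide), Pi.zero_apply, map_zero]; exact zero_lt_one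
  · rw [hent, Matrix.diagonal_apply_ne _ (by decide), Pi.zero_apply, map_zero]; exact zero_lt_one

/-- The Iwahori level lies in `K1` (`I = K0 ⊓ K1`). [cite: Tits1979, §3.7] -/
theorem I_le_K1 (K0 K1 I : Subgroup (Gqs L v)) (hI : I = K0 ⊓ K1) : I ≤ K1 := by
  subst hI; exact inf_le_right

/-- The Iwahori level lies in `K0`. [cite: Tits1979, §3.7] -/
theorem I_le_K0 (K0 K1 I : Subgroup (Gqs L v)) (hI : I = K0 ⊓ K1) : I ≤ K0 := by
  subst hI; exact inf_le_left

/-- **`eA⁻¹ w ∈ K0`** (the long Weyl element is an integral matrix, ★ `weylLongU_mem_glInt_subgroupOf`). [cite: Tits1979, §3.5] -/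
theorem eA_symm_weylLongU_mem_K0 (K0 : Subgroup (Gqs L v))
    (hK0 : K0 = ((glInt 3 (w.1.adicCompletion L)).subgroupOf
      (unitaryGroupOfForm (galAdicCompletionMap (L := L) (IsCMField.complexConj L) hw) ((StdForm.antidiagonal 3).over (w.1.adicCompletion L)))).comap
        eA.toMulEquiv.toMonoidHom) :
    eA.symm (weylLongU (galAdicCompletionMap (L := L) (IsCMField.complexConj L) hw) (rfl : (StdForm.antidiagonal 3).over (w.1.adicCompletion L) = _)) ∈ K0 := by
  subst hK0
  rw [Subgroup.mem_comap]
  change eA (eA.symm _) ∈ _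
  rw [ContinuousMulEquiv.apply_symm_apply]
  exact weylLongU_mem_glInt_subgroupOf _ rfl

include heA in
/-- **The diagonal of an upper-triangular `b ∈ B_v` whose `eA`-image has integral diagonal consists of units**: `σ(det)·det = 1` (★ `map_det_mul_det_eq_one_three`) and
`det = ∏ bᵢᵢ` (Mathlib `det_of_upperTriangular`), so `∏ |bᵢᵢ|_w = 1` with every factor `≤ 1`. [cite: Rogawski1990, §1.10 p. 9] [cite: PlatonovRapinchuk1994, §5.1] -/
theorem valued_diag_eq_one_of_mem_borel_of_forall_le (hd_vσ : ∀ a, Valued.v (galAdicCompletionMap (L := L) (IsCMField.complexConj L) hw a) = Valued.v a)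
    (g : Gqs L v)
    (hg : (g : ↥(unitaryGroupOfForm (conjLocal L (IsCMField.complexConj L) v) (cmLocalForm L 3 v))) ∈ (cmBorelTriple L 3 v).P)
    (hle : ∀ i : Fin 3, Valued.v ((g.val.val : Matrix (Fin 3) (Fin 3) (LocalRing L v)) i i w) ≤ 1) (i : Fin 3) :
    Valued.v ((g.val.val : Matrix (Fin 3) (Fin 3) (LocalRing L v)) i i w) = 1 := by
  set M : Matrix (Fin 3) (Fin 3) (w.1.adicCompletion L) :=
    (((eA g : ↥(unitaryGroupOfForm (galAdicCompletionMap (L := L) (IsCMField.complexConj L) hw) ((StdForm.antidiagonal 3).over (w.1.adicCompletion L)))) :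
      GL (Fin 3) (w.1.adicCompletion L)) : Matrix (Fin 3) (Fin 3) (w.1.adicCompletion L)) with hM
  have hent : ∀ i j : Fin 3, M i j = (g.val.val : Matrix (Fin 3) (Fin 3) (LocalRing L v)) i j w := fun i j =>
    coe_eA_apply L v w hw eA heA g i j
  -- `M` is upper triangular with `det M` of valuation one
  have htri : M.BlockTriangular id := (mem_borelU_iff _).1 ((eA_mem_borelU_iff L v w hw eA heA g).2 hg)
  have hdet : Valued.v M.det = 1 := by
    have h := congrArg Valued.v (map_det_mul_det_eq_one_three (galAdicCompletionMap (L := L) (IsCMField.complexConj L) hw) rfl (eA g))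
    rw [map_mul, hd_vσ, map_one] at h
    have h2 : Valued.v M.det * Valued.v M.det = 1 := h
    exact le_antisymm (by
      by_contra hlt
      push Not at hlt
      have : (1 : ℤᵐ⁰) < 1 := by
        calc (1 : ℤᵐ⁰) = Valued.v M.det * Valued.v M.det := h2.symm
          _ > 1 * 1 := mul_lt_mul'' hlt hlt zero_le_one zero_le_one
          _ = 1 := one_mul 1
      exact lt_irrefl _ this) (by
      by_contra hlt
      push Not at hlt
      have : (1 : ℤᵐ⁰) < 1 := by
        calc (1 : ℤᵐ⁰) = Valued.v M.det * Valued.v M.det := h2.symm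
          _ < 1 * 1 := mul_lt_mul_of_le_of_lt_of_nonneg_of_pos hlt.le hlt zero_le zero_lt_one
          _ = 1 := one_mul 1
      exact lt_irrefl _ this)
  rw [Matrix.det_of_upperTriangular htri, map_prod] at hdet
  -- every factor is `≤ 1`, the product is `1`
  have hle' : ∀ k ∈ (Finset.univ : Finset (Fin 3)), Valued.v (M k k) ≤ 1 := fun k _ => by rw [hent]; exact hle k
  have hge : 1 ≤ Valued.v (M i i) := by
    by_contra hlt
    push Not at hlt
    have hprod : ∏ k : Fin 3, Valued.v (M k k) < 1 := by
      calc ∏ k : Fin 3, Valued.v (M k k) = Valued.v (M i i) * ∏ k ∈ Finset.univ.erase i, Valued.v (M k k) :=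
            (Finset.mul_prod_erase _ _ (Finset.mem_univ i)).symm
        _ < 1 * 1 := by
            refine mul_lt_mul_of_lt_of_le_of_nonneg_of_pos hlt ?_ zero_le zero_lt_one
            exact Finset.prod_le_one (fun k _ => zero_le) fun k hk => hle' k (Finset.mem_univ k)
        _ = 1 := one_mul 1
    exact absurd hdet (ne_of_lt hprod)
  rw [← hent]
  exact le_antisymm (by rw [hent]; exact hle i) hge

/-! ## §2 The MACKEY binders at `G_v`: `G_v = B_v·I ⊔ B_v·(eA⁻¹w)·I` and `G_v = B_v·K1` (all products in the carrier of ★ `cmPrincipalSeries`) -/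

/-- Membership in a pulled-back level: `eA⁻¹ x ∈ H.comap eA ↔ x ∈ H`. [cite: PlatonovRapinchuk1994, §5.1] -/
theorem symm_mem_comap_iff (H : Subgroup ↥(unitaryGroupOfForm (galAdicCompletionMap (L := L) (IsCMField.complexConj L) hw) ((StdForm.antidiagonal 3).over (w.1.adicCompletion L)))) (x : ↥(unitaryGroupOfForm (galAdicCompletionMap (L := L) (IsCMField.complexConj L) hw) ((StdForm.antidiagonal 3).over (w.1.adicCompletion L)))) : eA.symm x ∈ H.comap eA.toMulEquiv.toMonoidHom ↔ x ∈ H := by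
  rw [Subgroup.mem_comap]
  change eA (eA.symm x) ∈ H ↔ x ∈ H
  rw [ContinuousMulEquiv.apply_symm_apply]

/-- Membership in a pulled-back level: `g ∈ H.comap eA ↔ eA g ∈ H`. [cite: PlatonovRapinchuk1994, §5.1] -/
theorem mem_comap_iff (H : Subgroup ↥(unitaryGroupOfForm (galAdicCompletionMap (L := L) (IsCMField.complexConj L) hw) ((StdForm.antidiagonal 3).over (w.1.adicCompletion L)))) (g : Gqs L v) : g ∈ H.comap eA.toMulEquiv.toMonoidHom ↔ eA g ∈ H := Iff.rfl

/-- `eA` on the two coset representatives `![1, eA⁻¹ w]` (read on the carrier of ★ `cmPrincipalSeries`). [cite: BruhatTits1972, (4.4.4)] -/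
theorem eA_vec (k : Fin 2) :
    (show ↥(unitaryGroupOfForm (conjLocal L (IsCMField.complexConj L) v) (cmLocalForm L 3 v)) ≃ₜ* ↥(unitaryGroupOfForm (galAdicCompletionMap (L := L) (IsCMField.complexConj L) hw) ((StdForm.antidiagonal 3).over (w.1.adicCompletion L))) from eA) (![(1 : ↥(unitaryGroupOfForm (conjLocal L (IsCMField.complexConj L) v) (cmLocalForm L 3 v))), eA.symm (weylLongU (galAdicCompletionMap (L := L) (IsCMField.complexConj L) hw) (rfl : (StdForm.antidiagonal 3).over (w.1.adicCompletion L) = _))] k) = ![(1 : ↥(unitaryGroupOfForm (galAdicCompletionMap (L := L) (IsCMField.complexConj L) hw) ((StdForm.antidiagonal 3).over (w.1.adicCompletion L)))), weylLongU (galAdicCompletionMap (L := L) (IsCMField.complexConj L) hw) (rfl : (StdForm.antidiagonal 3).over (w.1.adicCompletion L) = _)] k := by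
  fin_cases k
  · exact map_one (show ↥(unitaryGroupOfForm (conjLocal L (IsCMField.complexConj L) v) (cmLocalForm L 3 v)) ≃ₜ* ↥(unitaryGroupOfForm (galAdicCompletionMap (L := L) (IsCMField.complexConj L) hw) ((StdForm.antidiagonal 3).over (w.1.adicCompletion L))) from eA)
  · exact eA.apply_symm_apply _

include heA in
/-- **MACKEY's `hcover` at `H := B_v`, `K := I`, `ι := Fin 2`, `g := ![1, eA⁻¹ w]`** (★ `cover_borelU_inf` in the model, pulled back along `eA`). [cite: BruhatTits1972, (4.4.4)]
[cite: Casselman1995, Prop. 1.3.1] -/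
theorem cover_borel_I {ϖ : w.1.adicCompletion L} (hd : HermitianLattice.UnramifiedLocalConjDatum (galAdicCompletionMap (L := L) (IsCMField.complexConj L) hw) ϖ)
    (g₁ : GL (Fin 3) (w.1.adicCompletion L)) (hg₁ : (g₁ : Matrix (Fin 3) (Fin 3) (w.1.adicCompletion L)) = Matrix.diagonal ![(1 : w.1.adicCompletion L), 1, ϖ])
    (K0 K1 I : Subgroup (Gqs L v))
    (hK0 : K0 = ((glInt 3 (w.1.adicCompletion L)).subgroupOf
      (unitaryGroupOfForm (galAdicCompletionMap (L := L) (IsCMField.complexConj L) hw) ((StdForm.antidiagonal 3).over (w.1.adicCompletion L)))).comap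
        eA.toMulEquiv.toMonoidHom)
    (hK1 : K1 = (((glInt 3 (w.1.adicCompletion L)).map (MulAut.conj g₁).toMonoidHom).subgroupOf
      (unitaryGroupOfForm (galAdicCompletionMap (L := L) (IsCMField.complexConj L) hw) ((StdForm.antidiagonal 3).over (w.1.adicCompletion L)))).comap
        eA.toMulEquiv.toMonoidHom)
    (hI : I = K0 ⊓ K1) :
    ∀ y : ↥(unitaryGroupOfForm (conjLocal L (IsCMField.complexConj L) v) (cmLocalForm L 3 v)), ∃ i : Fin 2, ∃ h : ↥(cmBorelTriple L 3 v).P, ∃ κ : ↥(unitaryGroupOfForm (conjLocal L (IsCMField.complexConj L) v) (cmLocalForm L 3 v)), κ ∈ I ∧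
      y = (h : ↥(unitaryGroupOfForm (conjLocal L (IsCMField.complexConj L) v) (cmLocalForm L 3 v))) * (![(1 : ↥(unitaryGroupOfForm (conjLocal L (IsCMField.complexConj L) v) (cmLocalForm L 3 v))), eA.symm (weylLongU (galAdicCompletionMap (L := L) (IsCMField.complexConj L) hw) (rfl : (StdForm.antidiagonal 3).over (w.1.adicCompletion L) = _))] i) * κ := by
  subst hI hK0 hK1
  intro y
  let eU : ↥(unitaryGroupOfForm (conjLocal L (IsCMField.complexConj L) v) (cmLocalForm L 3 v)) ≃ₜ* ↥(unitaryGroupOfForm (galAdicCompletionMap (L := L) (IsCMField.complexConj L) hw) ((StdForm.antidiagonal 3).over (w.1.adicCompletion L))) := eA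
  obtain ⟨i, b, κ', hκ', hy⟩ := cover_borelU_inf (galAdicCompletionMap (L := L) (IsCMField.complexConj L) hw) rfl hd.σσ hd.vσ hd.vϖ g₁ hg₁ (eU y)
  refine ⟨i, ⟨eU.symm b, eA_symm_mem_borel L v w hw eA heA b.2⟩, eU.symm κ', ?_, ?_⟩
  · exact Subgroup.mem_inf.2 ⟨(symm_mem_comap_iff L v w hw eA _ _).2 (Subgroup.mem_inf.1 hκ').1,
      (symm_mem_comap_iff L v w hw eA _ _).2 (Subgroup.mem_inf.1 hκ').2⟩
  · apply eU.injective
    rw [map_mul, map_mul]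
    change eU y = eU (eU.symm _) * eU (![(1 : ↥(unitaryGroupOfForm (conjLocal L (IsCMField.complexConj L) v) (cmLocalForm L 3 v))), eA.symm (weylLongU (galAdicCompletionMap (L := L) (IsCMField.complexConj L) hw) (rfl : (StdForm.antidiagonal 3).over (w.1.adicCompletion L) = _))] i) * eU (eU.symm κ')
    rw [ContinuousMulEquiv.apply_symm_apply, ContinuousMulEquiv.apply_symm_apply, eA_vec L v w hw eA i]
    exact hy

include heA in
/-- **MACKEY's `hdisj`** for the same data (★ `disj_borelU_inf`, pushed forward along `eA`). [cite: BruhatTits1972, (4.4.4)] [cite: Casselman1995, Prop. 1.3.1] -/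
theorem disj_borel_I {ϖ : w.1.adicCompletion L} (hd : HermitianLattice.UnramifiedLocalConjDatum (galAdicCompletionMap (L := L) (IsCMField.complexConj L) hw) ϖ)
    (g₁ : GL (Fin 3) (w.1.adicCompletion L)) (hg₁ : (g₁ : Matrix (Fin 3) (Fin 3) (w.1.adicCompletion L)) = Matrix.diagonal ![(1 : w.1.adicCompletion L), 1, ϖ])
    (K0 K1 I : Subgroup (Gqs L v))
    (hK0 : K0 = ((glInt 3 (w.1.adicCompletion L)).subgroupOf
      (unitaryGroupOfForm (galAdicCompletionMap (L := L) (IsCMField.complexConj L) hw) ((StdForm.antidiagonal 3).over (w.1.adicCompletion L)))).comap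
        eA.toMulEquiv.toMonoidHom)
    (hK1 : K1 = (((glInt 3 (w.1.adicCompletion L)).map (MulAut.conj g₁).toMonoidHom).subgroupOf
      (unitaryGroupOfForm (galAdicCompletionMap (L := L) (IsCMField.complexConj L) hw) ((StdForm.antidiagonal 3).over (w.1.adicCompletion L)))).comap
        eA.toMulEquiv.toMonoidHom)
    (hI : I = K0 ⊓ K1) :
    ∀ i j : Fin 2, (∃ h : ↥(cmBorelTriple L 3 v).P, ∃ κ : ↥(unitaryGroupOfForm (conjLocal L (IsCMField.complexConj L) v) (cmLocalForm L 3 v)), κ ∈ I ∧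
      (![(1 : ↥(unitaryGroupOfForm (conjLocal L (IsCMField.complexConj L) v) (cmLocalForm L 3 v))), eA.symm (weylLongU (galAdicCompletionMap (L := L) (IsCMField.complexConj L) hw) (rfl : (StdForm.antidiagonal 3).over (w.1.adicCompletion L) = _))] j) = (h : ↥(unitaryGroupOfForm (conjLocal L (IsCMField.complexConj L) v) (cmLocalForm L 3 v))) * (![(1 : ↥(unitaryGroupOfForm (conjLocal L (IsCMField.complexConj L) v) (cmLocalForm L 3 v))), eA.symm (weylLongU (galAdicCompletionMap (L := L) (IsCMField.complexConj L) hw) (rfl : (StdForm.antidiagonal 3).over (w.1.adicCompletion L) = _))] i) * κ) → i = j := by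
  subst hI hK0 hK1
  rintro i j ⟨h, κ, hκ, e⟩
  let eU : ↥(unitaryGroupOfForm (conjLocal L (IsCMField.complexConj L) v) (cmLocalForm L 3 v)) ≃ₜ* ↥(unitaryGroupOfForm (galAdicCompletionMap (L := L) (IsCMField.complexConj L) hw) ((StdForm.antidiagonal 3).over (w.1.adicCompletion L))) := eA
  have hb : eU (h : ↥(unitaryGroupOfForm (conjLocal L (IsCMField.complexConj L) v) (cmLocalForm L 3 v))) ∈ borelU (galAdicCompletionMap (L := L) (IsCMField.complexConj L) hw) ((StdForm.antidiagonal 3).over (w.1.adicCompletion L)) :=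
    (eA_mem_borelU_iff L v w hw eA heA _).2 h.2
  have hκ' : eU κ ∈ (glInt 3 (w.1.adicCompletion L)).subgroupOf _ ⊓ ((glInt 3 (w.1.adicCompletion L)).map (MulAut.conj g₁).toMonoidHom).subgroupOf _ :=
    Subgroup.mem_inf.2 ⟨(mem_comap_iff L v w hw eA _ _).1 (Subgroup.mem_inf.1 hκ).1, (mem_comap_iff L v w hw eA _ _).1 (Subgroup.mem_inf.1 hκ).2⟩
  refine disj_borelU_inf (galAdicCompletionMap (L := L) (IsCMField.complexConj L) hw) rfl hd.vσ hd.vϖ g₁ hg₁ i j ⟨⟨_, hb⟩, eU κ, hκ', ?_⟩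
  calc ![(1 : ↥(unitaryGroupOfForm (galAdicCompletionMap (L := L) (IsCMField.complexConj L) hw) ((StdForm.antidiagonal 3).over (w.1.adicCompletion L)))), weylLongU (galAdicCompletionMap (L := L) (IsCMField.complexConj L) hw) (rfl : (StdForm.antidiagonal 3).over (w.1.adicCompletion L) = _)] j
      = eU (![(1 : ↥(unitaryGroupOfForm (conjLocal L (IsCMField.complexConj L) v) (cmLocalForm L 3 v))), eA.symm (weylLongU (galAdicCompletionMap (L := L) (IsCMField.complexConj L) hw) (rfl : (StdForm.antidiagonal 3).over (w.1.adicCompletion L) = _))] j) := (eA_vec L v w hw eA j).symm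
    _ = eU ((h : ↥(unitaryGroupOfForm (conjLocal L (IsCMField.complexConj L) v) (cmLocalForm L 3 v))) * (![(1 : ↥(unitaryGroupOfForm (conjLocal L (IsCMField.complexConj L) v) (cmLocalForm L 3 v))), eA.symm (weylLongU (galAdicCompletionMap (L := L) (IsCMField.complexConj L) hw) (rfl : (StdForm.antidiagonal 3).over (w.1.adicCompletion L) = _))] i) * κ) := by rw [e]
    _ = eU (h : ↥(unitaryGroupOfForm (conjLocal L (IsCMField.complexConj L) v) (cmLocalForm L 3 v))) * ![(1 : ↥(unitaryGroupOfForm (galAdicCompletionMap (L := L) (IsCMField.complexConj L) hw) ((StdForm.antidiagonal 3).over (w.1.adicCompletion L)))), weylLongU (galAdicCompletionMap (L := L) (IsCMField.complexConj L) hw) (rfl : (StdForm.antidiagonal 3).over (w.1.adicCompletion L) = _)] i * eU κ := by rw [map_mul, map_mul, eA_vec L v w hw eA i]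

include heA in
/-- **MACKEY's `hcover` at `H := B_v`, `K := K1`, `ι := Unit`, `g := fun _ => 1`** (★ `cover_borelU_conj_glInt`, pulled back along `eA`). [cite: Tits1979, §3.3.2]
[cite: Casselman1995, Prop. 1.3.1] -/
theorem cover_borel_K1 {ϖ : w.1.adicCompletion L} (hd : HermitianLattice.UnramifiedLocalConjDatum (galAdicCompletionMap (L := L) (IsCMField.complexConj L) hw) ϖ)
    (g₁ : GL (Fin 3) (w.1.adicCompletion L)) (hg₁ : (g₁ : Matrix (Fin 3) (Fin 3) (w.1.adicCompletion L)) = Matrix.diagonal ![(1 : w.1.adicCompletion L), 1, ϖ])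
    (K1 : Subgroup (Gqs L v))
    (hK1 : K1 = (((glInt 3 (w.1.adicCompletion L)).map (MulAut.conj g₁).toMonoidHom).subgroupOf
      (unitaryGroupOfForm (galAdicCompletionMap (L := L) (IsCMField.complexConj L) hw) ((StdForm.antidiagonal 3).over (w.1.adicCompletion L)))).comap
        eA.toMulEquiv.toMonoidHom) :
    ∀ y : ↥(unitaryGroupOfForm (conjLocal L (IsCMField.complexConj L) v) (cmLocalForm L 3 v)), ∃ _ : Unit, ∃ h : ↥(cmBorelTriple L 3 v).P, ∃ κ : ↥(unitaryGroupOfForm (conjLocal L (IsCMField.complexConj L) v) (cmLocalForm L 3 v)), κ ∈ K1 ∧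
      y = (h : ↥(unitaryGroupOfForm (conjLocal L (IsCMField.complexConj L) v) (cmLocalForm L 3 v))) * ((fun _ : Unit => (1 : ↥(unitaryGroupOfForm (conjLocal L (IsCMField.complexConj L) v) (cmLocalForm L 3 v)))) ()) * κ := by
  subst hK1
  intro y
  let eU : ↥(unitaryGroupOfForm (conjLocal L (IsCMField.complexConj L) v) (cmLocalForm L 3 v)) ≃ₜ* ↥(unitaryGroupOfForm (galAdicCompletionMap (L := L) (IsCMField.complexConj L) hw) ((StdForm.antidiagonal 3).over (w.1.adicCompletion L))) := eA
  obtain ⟨_, b, κ', hκ', hy⟩ := cover_borelU_conj_glInt (galAdicCompletionMap (L := L) (IsCMField.complexConj L) hw) rfl hd.σσ hd.vσ hd.vϖ g₁ hg₁ (eU y)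
  refine ⟨(), ⟨eU.symm b, eA_symm_mem_borel L v w hw eA heA b.2⟩, eU.symm κ', (symm_mem_comap_iff L v w hw eA _ _).2 hκ', ?_⟩
  apply eU.injective
  rw [map_mul, map_mul, map_one]
  change eU y = eU (eU.symm _) * 1 * eU (eU.symm κ')
  rw [ContinuousMulEquiv.apply_symm_apply, ContinuousMulEquiv.apply_symm_apply]
  exact hy

/-! ## §3 The three levels are compact open in `G_v` (★ (G0) p852870 on the model, pulled back along the homeomorphism `eA`) -/

/-- **`K0`, `K1`, `I` are compact open subgroups of `G_v`.** [cite: Tits1979, §3.2] [cite: BruhatTits1972, §10] -/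
theorem isOpen_isCompact_levels (g₁ : GL (Fin 3) (w.1.adicCompletion L))
    (K0 K1 I : Subgroup (Gqs L v))
    (hK0 : K0 = ((glInt 3 (w.1.adicCompletion L)).subgroupOf
      (unitaryGroupOfForm (galAdicCompletionMap (L := L) (IsCMField.complexConj L) hw) ((StdForm.antidiagonal 3).over (w.1.adicCompletion L)))).comap
        eA.toMulEquiv.toMonoidHom)
    (hK1 : K1 = (((glInt 3 (w.1.adicCompletion L)).map (MulAut.conj g₁).toMonoidHom).subgroupOf
      (unitaryGroupOfForm (galAdicCompletionMap (L := L) (IsCMField.complexConj L) hw) ((StdForm.antidiagonal 3).over (w.1.adicCompletion L)))).comap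
        eA.toMulEquiv.toMonoidHom)
    (hI : I = K0 ⊓ K1) :
    (IsOpen (K0 : Set (Gqs L v)) ∧ IsCompact (K0 : Set (Gqs L v))) ∧ (IsOpen (K1 : Set (Gqs L v)) ∧ IsCompact (K1 : Set (Gqs L v))) ∧
      (IsOpen (I : Set (Gqs L v)) ∧ IsCompact (I : Set (Gqs L v))) := by
  subst hI hK0 hK1
  have hσc : Continuous (galAdicCompletionMap (L := L) (IsCMField.complexConj L) hw) := continuous_galAdicCompletionMap L (IsCMField.complexConj L) hw
  haveI := compactSpace_integer_adicCompletion L w.1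
  have hpre : ∀ C : Subgroup ↥(unitaryGroupOfForm (galAdicCompletionMap (L := L) (IsCMField.complexConj L) hw) ((StdForm.antidiagonal 3).over (w.1.adicCompletion L))), ((C.comap eA.toMulEquiv.toMonoidHom : Subgroup (Gqs L v)) : Set (Gqs L v)) = eA ⁻¹' (C : Set ↥(unitaryGroupOfForm (galAdicCompletionMap (L := L) (IsCMField.complexConj L) hw) ((StdForm.antidiagonal 3).over (w.1.adicCompletion L)))) := fun _ => rfl
  have hK0o : IsOpen ((((glInt 3 (w.1.adicCompletion L)).subgroupOf
      (unitaryGroupOfForm (galAdicCompletionMap (L := L) (IsCMField.complexConj L) hw) ((StdForm.antidiagonal 3).over (w.1.adicCompletion L)))).comap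
        eA.toMulEquiv.toMonoidHom : Subgroup (Gqs L v)) : Set (Gqs L v)) := by
    rw [hpre]; exact (UnitaryLatticeTree.isOpen_glInt_subgroupOf (galAdicCompletionMap (L := L) (IsCMField.complexConj L) hw) _).preimage eA.continuous
  have hK0c : IsCompact ((((glInt 3 (w.1.adicCompletion L)).subgroupOf
      (unitaryGroupOfForm (galAdicCompletionMap (L := L) (IsCMField.complexConj L) hw) ((StdForm.antidiagonal 3).over (w.1.adicCompletion L)))).comap
        eA.toMulEquiv.toMonoidHom : Subgroup (Gqs L v)) : Set (Gqs L v)) := by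
    rw [hpre]; exact eA.toHomeomorph.isCompact_preimage.2 (UnitaryLatticeTree.isCompact_glInt_subgroupOf (galAdicCompletionMap (L := L) (IsCMField.complexConj L) hw) _ hσc)
  have hK1o : IsOpen (((((glInt 3 (w.1.adicCompletion L)).map (MulAut.conj g₁).toMonoidHom).subgroupOf
      (unitaryGroupOfForm (galAdicCompletionMap (L := L) (IsCMField.complexConj L) hw) ((StdForm.antidiagonal 3).over (w.1.adicCompletion L)))).comap
        eA.toMulEquiv.toMonoidHom : Subgroup (Gqs L v)) : Set (Gqs L v)) := by
    rw [hpre]; exact (UnitaryLatticeTree.isOpen_conj_glInt_subgroupOf (galAdicCompletionMap (L := L) (IsCMField.complexConj L) hw) _ g₁).preimage eA.continuous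
  have hK1c : IsCompact (((((glInt 3 (w.1.adicCompletion L)).map (MulAut.conj g₁).toMonoidHom).subgroupOf
      (unitaryGroupOfForm (galAdicCompletionMap (L := L) (IsCMField.complexConj L) hw) ((StdForm.antidiagonal 3).over (w.1.adicCompletion L)))).comap
        eA.toMulEquiv.toMonoidHom : Subgroup (Gqs L v)) : Set (Gqs L v)) := by
    rw [hpre]; exact eA.toHomeomorph.isCompact_preimage.2
      (UnitaryLatticeTree.isCompact_conj_glInt_subgroupOf (galAdicCompletionMap (L := L) (IsCMField.complexConj L) hw) _ g₁ hσc)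
  refine ⟨⟨hK0o, hK0c⟩, ⟨hK1o, hK1c⟩, ?_, ?_⟩
  · rw [Subgroup.coe_inf]; exact hK0o.inter hK1o
  · rw [Subgroup.coe_inf]; exact hK1c.inter_left (Subgroup.isClosed_of_isOpen _ hK0o)

end Summit.HodgeConjecture.HodgeConjecture.Cruxes.H413.F0P3cStCharTSStLevelsTransport

end
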